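/-
Copyright (c) 2026 the pub-hodgecm-mathlib formalisation cell (harness21).  Prover seat hodgecm-mathlib-LH4-p08 (g3), req620 Track A «(D-RAM) FOUR-FRAME» squad
(heir LEAD F0P3a-plan lineage; dealer LH4-plan (g11) WORD #26 (2); MS ROAD A, Stage B₂ brick B56₂-MULT INPUT, FILE G2-C1: the type-2 polarisation classes of the ROOT-GLUED
(`ρ = 0`) frame — explicit one-parameter family, structure, stabiliser-relatedness).  2026-09-04.
-/
import Summits.HodgeConjecture.HodgeConjecture.Theorems.F0P3cDyRamDiagonalGluedTubeCriterionTypeTwoZero   -- ★ p856303 (LH4-p09 (g2)): the `ρ = 0` frame is type-2 polarisable; brings ★ p856270 `isIntMatrix_smul_inv_fin_three`, ★ p855737 `formCongr_hnf_diagonal`, `det_coe_hnf`, `det_formCongr_diagonal`, `single_two_mem_latt_hnf_iff`, `isIntMatrix_of_fin_three`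
import Summits.HodgeConjecture.HodgeConjecture.Theorems.F0P3cDyRamDiagonalGluedRhoZero                     -- ★ p856296 (F0P3-p01 (g31)): `mem_latticeStabilizer_latt_rhoZero_iff`; brings ★ `ne_zero_and_v_lt_one_of_v_eq_exp`, ★ `v_pow_eq_exp_neg`
import HarnessLib

/-!
# Crux `H413`, MS ROAD A, STAGE B₂ brick B56₂-MULT, FILE G2-C1: «POLARISATION CLASSES OF THE ROOT-GLUED TYPE-2 FRAME (`ρ = 0`) — FAMILY, STRUCTURE, RELATEDNESS»

Cell `hodgecm-mathlib` (D-0151), FLOOR 0, crux item H413 = `stmt-HodgeConjecture-24833`; lane `--supports stmt-HodgeConjecture-24833 --as helper` (count-neutral).  THEOREMS ONLY.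
The type-2 multiplicity `polarisationCount σ ϖ 2 M = #(Δ₂(M) ∕ S_F(M))` (★ StrataDefs ED. 3; LH4-p09 (g2) flag 2026-09-04T00:42:58Z, LH4-p10 (g2) 00:58:37Z, dealer WORD #21∕#26, LEAD (R-21))
on the ROOT-GLUED stratum `G₁(1, s)`: `M = latt V`, `V = (1 0 0; 0 1 0; y″ ζ ϖ^{1+s})`, `|ζ| = 1`, `|y″| = |ϖ|^s`, `s` even `≥ 2` (★ p856303: ALWAYS polarisable).  LH4-p09 (g2)'s table
∕ F0P3-p01 (g31)'s socket₂ binder `hmult`: `n₂ = q − 1` here.  THIS FILE (the `ρ = 0` companion of ★ G2-A1∕A2 `…GluedPolarisation{Structure,Classes}TypeTwo`):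
* §1 `isVertexLattice_two_latt_glued_zero_explicit` — the ONE-PARAMETER FAMILY `D(α) = (Ny″·P·(αNζP − 1), α⁻¹ − PNζ, P)` (`P = π₀^{−s∕2}`, `α` any fixed unit; `α = 1` is ★ p856303's
  form): Gram entries `G₀₀ = α·Ny″NζP²`, `G₀₁ = σ(y″)Pζ`, `G₁₀ = σ(ζ)Py″`, `G₁₁ = α⁻¹` (rank one exactly), the rest in `𝔭`, `|det G| = |ϖ|²`.
* §2 (P1₀) STRUCTURE of an arbitrary polarisation `D`: `|D₂| = |ϖ|^{−s}` (dual-lattice bound + `G₁₂` integral + PARITY), the Gram units `G₀₀ = D₀ + Ny″D₂`, `G₁₁ = D₁ + NζD₂`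
  (the `(2,2)` cofactor `G₀₀G₁₁ − N(G₀₁)` lies in `𝔭` while `N(G₀₁) = Ny″NζD₂²` is a unit), `|D₀| = 1`, `|D₁| = |ϖ|^{−s}`.
* §3 (P2₀)∕(P3₀) RELATEDNESS through the invariant `r(D) := G₀₀∕D₂` (fixed, `|r(D)| = |ϖ|^s`): **`exists_stabiliser_iff_v_ratio_sub_le_zero`** —
  `(∃ u ∈ S_F(latt V), ∀ i, D′ i = D i·u i) ↔ |r(D) − r(D′)| ≤ |ϖ|^{s+1}` (★ p856296's stabiliser criterion `|u₂−u₁| ≤ |ϖ|^{1+s} ∧ |u₂−u₀| ≤ |ϖ|`).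
  So the classes are `r(D) mod U_F(1)`: `q − 1` of them — the COUNT is FILE G2-C2 (`…GluedZeroPolarisationCountTypeTwo`).
HONEST LABEL.  Count-neutral; the census laws stay PROVER TARGETS until the MS assembly lands; `HC_CM` is proved only modulo the 7 printed citations (2 remaining named inputs:
hLiu418 = `stmt-HodgeConjecture-24832`, h413 = `stmt-HodgeConjecture-24833`) until rung 0 closes.

## References
* [Jacobowitz1962] R. Jacobowitz, *Hermitian forms over local fields*, Amer. J. Math. 84 (1962), §7 (modular lattices, Gram matrices, dual bases).
* [Kottwitz1986BaseChangeUnits] R. Kottwitz, *Base change for unit elements of Hecke algebras*, Compositio Math. 60 (1986), §1 pp. 240–241 (fixed-lattice counting, torus stabilisers).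
* [Serre1979] J.-P. Serre, *Local Fields*, GTM 67 (1979), Ch. I §6 Prop. 18 (totally ramified quadratic extensions: fixed elements have even valuation).
-/

set_option autoImplicit false

noncomputable section

namespace Summit.HodgeConjecture.HodgeConjecture.Cruxes.H413.F0P3cDyRamDiagonalGluedZeroPolarisationClassesTypeTwo

open Matrix
open Literature.NumberTheory.Automorphic Literature.NumberTheory.Automorphic.HermitianLattice Literature.NumberTheory.Automorphic.UnitaryGroup
open Literature.NumberTheory.Automorphic.UnitaryLatticeTree
open Summit.HodgeConjecture.HodgeConjecture.Cruxes.H413.F0P3cDyRamDiagonalTorusDefs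
open Summit.HodgeConjecture.HodgeConjecture.Cruxes.H413.F0P3cDyRamDiagonalStableLatticeHNF
open Summit.HodgeConjecture.HodgeConjecture.Cruxes.H413.F0P3cDyRamDiagonalGluedTubeCriterion
open Summit.HodgeConjecture.HodgeConjecture.Cruxes.H413.F0P3cDyRamDiagonalGluedTubeCriterionTypeTwo
open Summit.HodgeConjecture.HodgeConjecture.Cruxes.H413.F0P3cDyRamDiagonalGluedStabiliserIndex
open Summit.HodgeConjecture.HodgeConjecture.Cruxes.H413.F0P3cDyRamDiagonalGluedRhoZero
open scoped Valued WithZero Matrix MatrixGroups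

variable {K : Type*} [Field K] [Valued K ℤᵐ⁰]

/-! ## §1  The one-parameter family of explicit forms -/

/-- **THE FAMILY `D(α)`**: for every fixed unit `α`, the fixed diagonal form `D(α) = (Ny″·P·(α·Nζ·P − 1), α⁻¹ − P·Nζ, P)` (`P = π₀^{−s∕2}`, `π₀ = ϖσϖ`, `Nζ = ζσζ`, `Ny″ = y″σy″`) polarises
`latt (1 0 0; 0 1 0; y″ ζ ϖ^{1+s})` at type 2: `G₀₀ = α·Ny″NζP²`, `G₀₁ = σ(y″)Pζ`, `G₁₀ = σ(ζ)Py″`, `G₁₁ = α⁻¹` (so `G₀₀G₁₁ = G₀₁G₁₀`), the rest in `𝔭`, `|det G| = |ϖ|²`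
(★ p856303 is `α = 1`; proof adapted from it). [cite: Jacobowitz1962, §7] [cite: Kottwitz1986BaseChangeUnits, §1 pp. 240–241] -/
theorem isVertexLattice_two_latt_glued_zero_explicit {σ : K →+* K} (hσ : ∀ a, σ (σ a) = a) (hvσ : ∀ a, Valued.v (σ a) = Valued.v a)
    {ϖ : K} (hϖ0 : ϖ ≠ 0) (hϖ1 : Valued.v ϖ < 1) (s : ℕ) (hs2 : 2 ∣ s) (hs : 1 ≤ s) {ζ y'' : K} (hζ : Valued.v ζ = 1) (hy'' : Valued.v y'' = Valued.v ϖ ^ s)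
    (V : GL (Fin 3) K) (hV : (V : Matrix (Fin 3) (Fin 3) K) = !![1, 0, 0; 0, 1, 0; y'', ζ, ϖ ^ (1 + s)])
    {α : K} (hσα : σ α = α) (hvα : Valued.v α = 1) {P D₁ D₀ : K} (hP : P = ((ϖ * σ ϖ) ^ (s / 2))⁻¹)
    (hD₁ : D₁ = α⁻¹ - P * (ζ * σ ζ)) (hD₀ : D₀ = σ y'' * y'' * P * (α * (ζ * σ ζ) * P - 1)) :
    (∀ i, σ ((![D₀, D₁, P] : Fin 3 → K) i) = (![D₀, D₁, P] : Fin 3 → K) i ∧ (![D₀, D₁, P] : Fin 3 → K) i ≠ 0) ∧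
      IsVertexLattice σ ϖ (Matrix.diagonal ![D₀, D₁, P]) 2 (latt (V : Matrix (Fin 3) (Fin 3) K)) := by
  -- adapted from ★ p856303 `isTypeTwoPolarisable_latt_hnf_glued_zero` (LH4-p09 (g2)), with the extra unit parameter `α`
  obtain ⟨t, rfl⟩ := hs2
  have ht : 1 ≤ t := by omega
  rw [show 2 * t / 2 = t by omega] at hP
  have hvϖ : 0 < Valued.v ϖ := (Valuation.pos_iff _).2 hϖ0
  have hϖ1' : Valued.v ϖ ≤ 1 := hϖ1.le
  have hpowle : ∀ n : ℕ, Valued.v ϖ ^ n ≤ 1 := fun n => pow_le_one₀ zero_le hϖ1'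
  have hα0 : α ≠ 0 := fun h => by rw [h, map_zero] at hvα; exact zero_ne_one hvα
  have hvαi : Valued.v α⁻¹ = 1 := by rw [map_inv₀, hvα, inv_one]
  set Nζ : K := ζ * σ ζ with hNζ
  have hvNζ : Valued.v Nζ = 1 := by rw [hNζ, map_mul, hvσ, hζ, one_mul]
  have hσNζ : σ Nζ = Nζ := by rw [hNζ, map_mul, hσ, mul_comm]
  set π₀ : K := ϖ * σ ϖ with hπ₀
  have hσπ₀ : σ π₀ = π₀ := by rw [hπ₀, map_mul, hσ, mul_comm]
  have hvπ₀ : Valued.v π₀ = Valued.v ϖ ^ 2 := by rw [hπ₀, map_mul, hvσ, sq]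
  have hσϖ0 : σ ϖ ≠ 0 := fun h => hϖ0 (by rw [← hσ ϖ, h, map_zero])
  have hπ₀0 : π₀ ≠ 0 := mul_ne_zero hϖ0 hσϖ0
  set E2 : ℤᵐ⁰ := Valued.v ϖ ^ (2 * t) with hE2
  have hE20 : E2 ≠ 0 := pow_ne_zero _ hvϖ.ne'
  have hE21 : E2 < 1 := by rw [hE2]; exact pow_lt_one₀ zero_le hϖ1 (by omega)
  have hvP : Valued.v P = E2⁻¹ := by rw [hP, map_inv₀, map_pow, hvπ₀, ← pow_mul, hE2]
  have hP0 : P ≠ 0 := by rw [hP]; exact inv_ne_zero (pow_ne_zero _ hπ₀0)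
  have hσP : σ P = P := by rw [hP, map_inv₀, map_pow, hσπ₀]
  have hvPN : Valued.v (P * Nζ) = E2⁻¹ := by rw [map_mul, hvP, hvNζ, mul_one]
  have h1lt : Valued.v (α⁻¹ : K) < Valued.v (P * Nζ) := by rw [hvαi, hvPN]; exact one_lt_inv_iff₀.2 ⟨(zero_lt_iff.2 hE20), hE21⟩
  have h1lt' : Valued.v (1 : K) < Valued.v (α * Nζ * P) := by
    rw [map_one, map_mul, map_mul, hvα, hvNζ, one_mul, one_mul, hvP]; exact one_lt_inv_iff₀.2 ⟨(zero_lt_iff.2 hE20), hE21⟩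
  have hvϖc : Valued.v (ϖ ^ (1 + 2 * t)) = E2 * Valued.v ϖ := by rw [map_pow, add_comm, pow_succ]
  have hPc : E2⁻¹ * (E2 * Valued.v ϖ) = Valued.v ϖ := by rw [← mul_assoc, inv_mul_cancel₀ hE20, one_mul]
  have hvNy : Valued.v (σ y'' * y'') = E2 * E2 := by rw [map_mul, hvσ, hy'', hE2]
  -- the form
  have hvD₁ : Valued.v D₁ = E2⁻¹ := by
    rw [hD₁, sub_eq_add_neg, Valuation.map_add_eq_of_lt_right _ (by rwa [Valuation.map_neg]), Valuation.map_neg, hvPN]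
  have hvNP1 : Valued.v (α * Nζ * P - 1) = E2⁻¹ := by
    rw [sub_eq_add_neg, Valuation.map_add_eq_of_lt_left _ (by rwa [Valuation.map_neg]), map_mul, map_mul, hvα, hvNζ, one_mul, one_mul, hvP]
  have hvD₀ : Valued.v D₀ = 1 := by
    rw [hD₀, map_mul, map_mul, hvNy, hvP, hvNP1, mul_assoc, mul_assoc, ← mul_assoc E2 E2⁻¹ E2⁻¹, mul_inv_cancel₀ hE20, one_mul, mul_inv_cancel₀ hE20]
  have hD₁0 : D₁ ≠ 0 := fun h => by rw [h, map_zero] at hvD₁; exact (inv_ne_zero hE20) hvD₁.symm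
  have hD₀0 : D₀ ≠ 0 := fun h => by rw [h, map_zero] at hvD₀; exact zero_ne_one hvD₀
  have hσD₁ : σ D₁ = D₁ := by rw [hD₁, map_sub, map_inv₀, hσα, map_mul, hσP, hσNζ]
  have hσD₀ : σ D₀ = D₀ := by rw [hD₀]; simp only [map_mul, map_sub, map_one, hσ, hσP, hσNζ, hσα]; ring
  set D : Fin 3 → K := ![D₀, D₁, P] with hDdef
  have hD0 : D 0 = D₀ := rfl; have hD1 : D 1 = D₁ := rfl; have hD2 : D 2 = P := rfl
  refine ⟨fun i => ?_, ?_⟩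
  · fin_cases i; exacts [⟨hσD₀, hD₀0⟩, ⟨hσD₁, hD₁0⟩, ⟨hσP, hP0⟩]
  -- the Gram matrix, entry by entry
  have hG := formCongr_hnf_diagonal σ D 0 y'' ζ 1 (ϖ ^ (1 + 2 * t)) V (by rw [hV])
  rw [hD0, hD1, hD2] at hG
  have e00 : D₀ + σ 0 * D₁ * 0 + σ y'' * P * y'' = α * (σ y'' * y'' * P * (Nζ * P)) := by rw [hD₀, map_zero]; ring
  have e01 : σ 0 * D₁ * 1 + σ y'' * P * ζ = σ y'' * P * ζ := by rw [map_zero]; ring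
  have e10 : σ 1 * D₁ * 0 + σ ζ * P * y'' = σ ζ * P * y'' := by ring
  have e11 : σ 1 * D₁ * 1 + σ ζ * P * ζ = α⁻¹ := by rw [map_one, hD₁, hNζ]; ring
  have hvσϖc : Valued.v (σ (ϖ ^ (1 + 2 * t))) = E2 * Valued.v ϖ := by rw [hvσ, hvϖc]
  have h00 : Valued.v (D₀ + σ 0 * D₁ * 0 + σ y'' * P * y'') ≤ 1 := by
    rw [e00]
    simp only [map_mul, hvσ, hy'', hvP, hvNζ, hvα, one_mul]
    rw [mul_assoc E2 E2 E2⁻¹, mul_inv_cancel₀ hE20, mul_one, mul_inv_cancel₀ hE20]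
  have h01 : Valued.v (σ 0 * D₁ * 1 + σ y'' * P * ζ) ≤ 1 := by
    rw [e01, map_mul, map_mul, hvσ, hy'', hvP, hζ, mul_one, mul_inv_cancel₀ hE20]
  have h10 : Valued.v (σ 1 * D₁ * 0 + σ ζ * P * y'') ≤ 1 := by
    rw [e10, map_mul, map_mul, hvσ, hζ, hvP, hy'', one_mul, inv_mul_cancel₀ hE20]
  have h11 : Valued.v (σ 1 * D₁ * 1 + σ ζ * P * ζ) ≤ 1 := by rw [e11, hvαi]
  have h02 : Valued.v (σ y'' * P * ϖ ^ (1 + 2 * t)) ≤ Valued.v ϖ := by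
    rw [map_mul, map_mul, hvσ, hvP, hvϖc, mul_assoc, hPc, hy'']; exact mul_le_of_le_one_left' (hpowle _)
  have h12 : Valued.v (σ ζ * P * ϖ ^ (1 + 2 * t)) ≤ Valued.v ϖ := by
    rw [map_mul, map_mul, hvσ, hζ, one_mul, hvP, hvϖc, hPc]
  have h20 : Valued.v (σ (ϖ ^ (1 + 2 * t)) * P * y'') ≤ Valued.v ϖ := by
    rw [map_mul, map_mul, hvσϖc, hvP, mul_comm (E2 * Valued.v ϖ) E2⁻¹, hPc, hy'']; exact mul_le_of_le_one_right' (hpowle _)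
  have h21 : Valued.v (σ (ϖ ^ (1 + 2 * t)) * P * ζ) ≤ Valued.v ϖ := by
    rw [map_mul, map_mul, hvσϖc, hvP, mul_comm (E2 * Valued.v ϖ) E2⁻¹, hPc, hζ, mul_one]
  have h22 : Valued.v (σ (ϖ ^ (1 + 2 * t)) * P * ϖ ^ (1 + 2 * t)) ≤ Valued.v ϖ := by
    rw [map_mul, map_mul, hvσϖc, hvP, mul_comm (E2 * Valued.v ϖ) E2⁻¹, hPc, map_pow]; exact mul_le_of_le_one_right' (hpowle _)
  have hrk : (D₀ + σ 0 * D₁ * 0 + σ y'' * P * y'') * (σ 1 * D₁ * 1 + σ ζ * P * ζ) = (σ 0 * D₁ * 1 + σ y'' * P * ζ) * (σ 1 * D₁ * 0 + σ ζ * P * y'') := by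
    rw [e00, e01, e10, e11, hNζ]; field_simp
  have hGint : IsIntMatrix (formCongr σ V (Matrix.diagonal D)) := by
    rw [hG]
    exact isIntMatrix_of_fin_three h00 h01 (h02.trans hϖ1') h10 h11 (h12.trans hϖ1') (h20.trans hϖ1') (h21.trans hϖ1') (h22.trans hϖ1')
  have hdet : Valued.v (formCongr σ V (Matrix.diagonal D)).det = Valued.v ϖ ^ 2 := by
    rw [det_formCongr_diagonal, det_coe_hnf 0 y'' ζ 1 (ϖ ^ (1 + 2 * t)) V (by rw [hV]), hD0, hD1, hD2, one_mul]
    simp only [map_mul, hvD₀, hvD₁, hvP, hvϖc, hvσϖc, one_mul]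
    calc E2 * Valued.v ϖ * (E2⁻¹ * E2⁻¹) * (E2 * Valued.v ϖ) = (E2 * E2⁻¹) * (E2 * E2⁻¹) * (Valued.v ϖ * Valued.v ϖ) := by ac_rfl
      _ = Valued.v ϖ ^ 2 := by rw [mul_inv_cancel₀ hE20, one_mul, one_mul, sq]
  have hdet' := hdet
  rw [hG] at hdet'
  have hinv : IsIntMatrix (ϖ • (formCongr σ V (Matrix.diagonal D))⁻¹) := by
    rw [hG]
    exact isIntMatrix_smul_inv_fin_three hϖ0 hϖ1' hdet' h00 h01 h10 h11 h02 h12 h20 h21 h22 hrk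
  exact (isVertexLattice_latt_iff_of_v σ hvσ hϖ0 (Matrix.diagonal D) 2 V).2 ⟨hGint, hinv, hdet⟩

/-! ## §2 (P1₀)  Structure of an arbitrary type-2 polarisation of the root-glued frame -/

/-- **(P1₀) STRUCTURE**: for a fixed non-degenerate `diag D` polarising `latt (1 0 0; 0 1 0; y″ ζ ϖ^{1+s})` at type 2 (`|ζ| = 1`, `|y″| = |ϖ|^s`, `s` even `≥ 2`): `|D₂| = |ϖ|^{−s}` EXACTLY
(`ϖD₂⁻¹e₃ ∈ ϖM^♯ ⊆ M` gives `|D₂|⁻¹ ≤ |ϖ|^s`, the Gram entry `G₁₂ = σ(ζ)D₂ϖ^{1+s}` is integral, and fixed valuations are even); the Gram entries `G₀₀ = D₀ + Ny″D₂` and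
`G₁₁ = D₁ + NζD₂` are fixed UNITS with `|G₀₀G₁₁ − Ny″NζD₂²| ≤ |ϖ|` (the `(2,2)` cofactor of an integral matrix with `ϖ·G⁻¹` integral, against the unit `N(G₀₁) = Ny″NζD₂²`);
`|D₀| = 1`, `|D₁| = |ϖ|^{−s}`. [cite: Jacobowitz1962, §7] [cite: Kottwitz1986BaseChangeUnits, §1 pp. 240–241] [cite: Serre1979, Ch. I §6 Prop. 18] -/
theorem structure_of_polarisation_zero {σ : K →+* K} (hvσ : ∀ a, Valued.v (σ a) = Valued.v a)
    (hfix : ∀ x : K, σ x = x → x ≠ 0 → ∃ n : ℤ, Valued.v x = WithZero.exp (2 * n)) {ϖ : K} (hϖ : Valued.v ϖ = WithZero.exp (-1 : ℤ))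
    (s : ℕ) (hs2 : 2 ∣ s) (hs : 1 ≤ s) {ζ y'' : K} (hζ : Valued.v ζ = 1) (hy'' : Valued.v y'' = Valued.v ϖ ^ s)
    (V : GL (Fin 3) K) (hV : (V : Matrix (Fin 3) (Fin 3) K) = !![1, 0, 0; 0, 1, 0; y'', ζ, ϖ ^ (1 + s)])
    {D : Fin 3 → K} (hD : ∀ i, σ (D i) = D i ∧ D i ≠ 0) (hvert : IsVertexLattice σ ϖ (Matrix.diagonal D) 2 (latt (V : Matrix (Fin 3) (Fin 3) K))) :
    Valued.v (D 2) = (Valued.v ϖ ^ s)⁻¹ ∧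
      (Valued.v (D 0 + σ y'' * D 2 * y'') = 1 ∧ Valued.v (D 1 + σ ζ * D 2 * ζ) = 1 ∧
        Valued.v ((D 0 + σ y'' * D 2 * y'') * (D 1 + σ ζ * D 2 * ζ) - σ y'' * y'' * (σ ζ * ζ) * D 2 ^ 2) ≤ Valued.v ϖ) ∧
      (Valued.v (D 0) = 1 ∧ Valued.v (D 1) = (Valued.v ϖ ^ s)⁻¹) := by
  obtain ⟨hϖ0, hϖ1⟩ := ne_zero_and_v_lt_one_of_v_eq_exp hϖ
  have hvϖ : 0 < Valued.v ϖ := (Valuation.pos_iff _).2 hϖ0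
  set c : ℕ := 1 + s with hc
  have hrc : (ϖ ^ c : K) ≠ 0 := pow_ne_zero _ hϖ0
  have hD2 : D 2 ≠ 0 := (hD 2).2
  set Es : ℤᵐ⁰ := Valued.v ϖ ^ s with hEs
  have hEs0 : Es ≠ 0 := pow_ne_zero _ hvϖ.ne'
  have hEs1 : Es < 1 := pow_lt_one₀ zero_le hϖ1 (by omega)
  obtain ⟨hG, hinv, hdet⟩ := (isVertexLattice_latt_iff_of_v σ hvσ hϖ0 (Matrix.diagonal D) 2 V).1 hvert
  have hGeq := formCongr_hnf_diagonal σ D 0 y'' ζ 1 (ϖ ^ c) V (by rw [hV])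
  -- (i) `|D₂|⁻¹ ≤ |ϖ|^s`: `ϖ·D₂⁻¹e₃ ∈ ϖM^♯ ⊆ M`
  have hdetD : IsUnit (Matrix.diagonal D).det := by
    rw [Matrix.det_diagonal, Fin.prod_univ_three]
    exact (mul_ne_zero (mul_ne_zero (hD 0).2 (hD 1).2) hD2).isUnit
  have hint : ∀ m ∈ latt (V : Matrix (Fin 3) (Fin 3) K), ∀ i, Valued.v (m i) ≤ 1 := by
    intro m hm i
    rw [hV] at hm
    have hle := latt_hnf_le_stdLattice (x := (0 : K)) (y := y'') (z := ζ) (p := (1 : K)) (r := ϖ ^ c) (by rw [map_zero]; exact zero_le_one)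
      (by rw [hy'']; exact pow_le_one₀ zero_le hϖ1.le) hζ.le (by rw [map_one]) (by rw [map_pow]; exact pow_le_one₀ zero_le hϖ1.le)
    exact (mem_stdLattice.1 (hle hm)) i
  have hw' : Pi.single (2 : Fin 3) (D 2)⁻¹ ∈ dualLatt σ (Matrix.diagonal D) (latt (V : Matrix (Fin 3) (Fin 3) K)) := by
    rw [mem_dualLatt]
    intro m hm
    rw [pairing_apply]
    have hsum : ∑ i : Fin 3, ∑ j : Fin 3, σ (m i) * Matrix.diagonal D i j * (Pi.single (2 : Fin 3) (D 2)⁻¹ : Fin 3 → K) j = σ (m 2) := by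
      simp [Matrix.diagonal, Pi.single_apply, hD2]
    rw [hsum, hvσ]
    exact hint m hm 2
  have hw : Pi.single (2 : Fin 3) (ϖ * (D 2)⁻¹) ∈ latt (V : Matrix (Fin 3) (Fin 3) K) := by
    refine scaleLattice_dualLatt_le_of_isVertexLattice hvσ hdetD hvert ((mem_scaleLattice_iff hϖ0 _ _).2 ?_)
    rwa [← smul_eq_mul, Pi.single_smul', smul_smul, inv_mul_cancel₀ hϖ0, one_smul]
  have hlow : Valued.v (D 2)⁻¹ ≤ Es := by
    rw [hV] at hw
    have h := (single_two_mem_latt_hnf_iff (0 : K) y'' ζ one_ne_zero hrc _).1 hw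
    rw [map_mul, map_pow, hc, add_comm, pow_succ, mul_comm Es] at h
    rw [map_inv₀]; rw [map_inv₀] at h
    exact le_of_mul_le_mul_left h hvϖ
  -- (ii) `|D₂|·|ϖ|^{1+s} ≤ 1` from `G₁₂`
  have h12 := hG 1 2
  rw [hGeq] at h12
  simp only [Matrix.of_apply, Matrix.cons_val', Matrix.cons_val_zero, Matrix.cons_val_one, Matrix.cons_val_two, Matrix.empty_val', Matrix.cons_val_fin_one,
    Matrix.tail_cons, Matrix.head_cons] at h12
  rw [map_mul, map_mul, hvσ, hζ, one_mul, map_pow] at h12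
  -- parity
  have hvD2 : Valued.v (D 2) = Es⁻¹ := by
    obtain ⟨n, hn⟩ := hfix (D 2) (hD 2).1 hD2
    obtain ⟨t, rfl⟩ := hs2
    rw [map_inv₀] at hlow
    rw [hn] at h12 hlow ⊢
    rw [hEs, v_pow_eq_exp_neg hϖ] at hlow ⊢
    rw [v_pow_eq_exp_neg hϖ] at h12
    rw [← WithZero.exp_neg] at hlow ⊢
    rw [← WithZero.exp_add, ← WithZero.exp_zero, WithZero.exp_le_exp] at h12
    rw [WithZero.exp_le_exp] at hlow
    congr 1
    push_cast at h12 hlow ⊢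
    omega
  -- (iii) the Gram units and the cofactor
  have h00 := hG 0 0
  have h11 := hG 1 1
  have hc22 := hinv 2 2
  have hadj : (formCongr σ V (Matrix.diagonal D)).adjugate 2 2 =
      (D 0 + σ 0 * D 1 * 0 + σ y'' * D 2 * y'') * (σ 1 * D 1 * 1 + σ ζ * D 2 * ζ) - (σ 0 * D 1 * 1 + σ y'' * D 2 * ζ) * (σ 1 * D 1 * 0 + σ ζ * D 2 * y'') := by
    rw [hGeq, Matrix.adjugate_fin_three_of]; rfl
  rw [Matrix.smul_apply, Matrix.inv_def, Ring.inverse_eq_inv, Matrix.smul_apply, smul_eq_mul, smul_eq_mul, map_mul, map_mul, map_inv₀, hdet, hadj] at hc22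
  rw [hGeq] at h00 h11
  simp only [Matrix.of_apply, Matrix.cons_val', Matrix.cons_val_zero, Matrix.cons_val_one, Matrix.empty_val', Matrix.cons_val_fin_one] at h00 h11
  have e00 : D 0 + σ 0 * D 1 * 0 + σ y'' * D 2 * y'' = D 0 + σ y'' * D 2 * y'' := by rw [map_zero]; ring
  have e11 : σ 1 * D 1 * 1 + σ ζ * D 2 * ζ = D 1 + σ ζ * D 2 * ζ := by rw [map_one]; ring
  have ecof : (D 0 + σ 0 * D 1 * 0 + σ y'' * D 2 * y'') * (σ 1 * D 1 * 1 + σ ζ * D 2 * ζ) - (σ 0 * D 1 * 1 + σ y'' * D 2 * ζ) * (σ 1 * D 1 * 0 + σ ζ * D 2 * y'') =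
      (D 0 + σ y'' * D 2 * y'') * (D 1 + σ ζ * D 2 * ζ) - σ y'' * y'' * (σ ζ * ζ) * D 2 ^ 2 := by rw [map_zero, map_one]; ring
  rw [e00] at h00; rw [e11] at h11; rw [ecof] at hc22
  -- `|ϖ|·|ϖ|⁻²·|cof| ≤ 1 ⟹ |cof| ≤ |ϖ|`
  have hcof : Valued.v ((D 0 + σ y'' * D 2 * y'') * (D 1 + σ ζ * D 2 * ζ) - σ y'' * y'' * (σ ζ * ζ) * D 2 ^ 2) ≤ Valued.v ϖ := by
    rw [sq, ← mul_assoc, mul_comm (Valued.v ϖ) (Valued.v ϖ * Valued.v ϖ)⁻¹, mul_inv, mul_assoc (Valued.v ϖ)⁻¹, inv_mul_cancel₀ hvϖ.ne', mul_one,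
      inv_mul_le_iff₀ hvϖ, mul_one] at hc22
    exact hc22
  -- the unit `N(G₀₁) = Ny″NζD₂²`
  have hvN : Valued.v (σ y'' * y'' * (σ ζ * ζ) * D 2 ^ 2) = 1 := by
    rw [map_mul, map_mul, map_mul, map_mul, map_pow, hvσ, hvσ, hy'', hζ, hvD2, mul_one, mul_one, sq, mul_assoc, ← mul_assoc Es Es⁻¹ Es⁻¹,
      mul_inv_cancel₀ hEs0, one_mul, mul_inv_cancel₀ hEs0]
  have hprod : Valued.v ((D 0 + σ y'' * D 2 * y'') * (D 1 + σ ζ * D 2 * ζ)) = 1 := by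
    have e : (D 0 + σ y'' * D 2 * y'') * (D 1 + σ ζ * D 2 * ζ) =
        σ y'' * y'' * (σ ζ * ζ) * D 2 ^ 2 + ((D 0 + σ y'' * D 2 * y'') * (D 1 + σ ζ * D 2 * ζ) - σ y'' * y'' * (σ ζ * ζ) * D 2 ^ 2) := by ring
    rw [e, Valuation.map_add_eq_of_lt_left _ (by rw [hvN]; exact hcof.trans_lt hϖ1), hvN]
  rw [map_mul] at hprod
  have hu00 : Valued.v (D 0 + σ y'' * D 2 * y'') = 1 :=
    le_antisymm h00 (by
      by_contra hlt
      rw [not_le] at hlt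
      have : Valued.v (D 0 + σ y'' * D 2 * y'') * Valued.v (D 1 + σ ζ * D 2 * ζ) < 1 * 1 := mul_lt_mul_of_lt_of_le_of_nonneg_of_pos hlt h11 zero_le zero_lt_one
      rw [hprod, one_mul] at this
      exact lt_irrefl _ this)
  have hu11 : Valued.v (D 1 + σ ζ * D 2 * ζ) = 1 := by rwa [hu00, one_mul] at hprod
  -- `|D₀| = 1`, `|D₁| = |ϖ|^{−s}`
  have hvNy2 : Valued.v (σ y'' * D 2 * y'') = Es := by
    rw [map_mul, map_mul, hvσ, hy'', hvD2, mul_assoc, inv_mul_cancel₀ hEs0, mul_one]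
  have hvNζ2 : Valued.v (σ ζ * D 2 * ζ) = Es⁻¹ := by rw [map_mul, map_mul, hvσ, hζ, hvD2, one_mul, mul_one]
  have hvD0 : Valued.v (D 0) = 1 := by
    have e : D 0 = (D 0 + σ y'' * D 2 * y'') + -(σ y'' * D 2 * y'') := by ring
    rw [e, Valuation.map_add_eq_of_lt_left _ (by rw [Valuation.map_neg, hvNy2, hu00]; exact hEs1), hu00]
  have hvD1 : Valued.v (D 1) = Es⁻¹ := by
    have e : D 1 = (D 1 + σ ζ * D 2 * ζ) + -(σ ζ * D 2 * ζ) := by ring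
    rw [e, Valuation.map_add_eq_of_lt_right _ (by rw [Valuation.map_neg, hvNζ2, hu11]; exact one_lt_inv_iff₀.2 ⟨zero_lt_iff.2 hEs0, hEs1⟩),
      Valuation.map_neg, hvNζ2]
  exact ⟨hvD2, ⟨hu00, hu11, hcof⟩, ⟨hvD0, hvD1⟩⟩

/-! ## §3 (P2₀)∕(P3₀)  Stabiliser-relatedness through the invariant `r(D) = G₀₀ ∕ D₂` -/

/-- **(P2₀) `D′ = D·u`, `u ∈ S_F(latt V)` ⟹ `|r(D) − r(D′)| ≤ |ϖ|^{s+1}`** (`r(D) = (D₀ + Ny″D₂)∕D₂`): `r(D) − r(D′) = (D₀∕D₂)(u₂ − u₀)∕u₂`, `|D₀∕D₂| = |ϖ|^s`, and the stabiliser of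
the root-glued frame obeys `|u₂ − u₀| ≤ |ϖ|` (★ p856296 `mem_latticeStabilizer_latt_rhoZero_iff`). [cite: Kottwitz1986BaseChangeUnits, §1 pp. 240–241] -/
theorem v_ratio_sub_le_of_exists_stabiliser_zero {σ : K →+* K} {ϖ : K} (hϖ0 : ϖ ≠ 0) (s : ℕ) {ζ y'' : K} (hζ : Valued.v ζ = 1) (hy'' : Valued.v y'' = Valued.v ϖ ^ s)
    (V : GL (Fin 3) K) (hV : (V : Matrix (Fin 3) (Fin 3) K) = !![1, 0, 0; 0, 1, 0; y'', ζ, ϖ ^ (1 + s)])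
    {D D' : Fin 3 → K} (hD2 : D 2 ≠ 0) (hvD2 : Valued.v (D 2) = (Valued.v ϖ ^ s)⁻¹) (hvD0 : Valued.v (D 0) = 1)
    (h : ∃ u ∈ fixedUnitStabilizer σ (latt (V : Matrix (Fin 3) (Fin 3) K)), ∀ i, D' i = D i * ((u i : Kˣ) : K)) :
    Valued.v ((D 0 + σ y'' * D 2 * y'') / D 2 - (D' 0 + σ y'' * D' 2 * y'') / D' 2) ≤ Valued.v ϖ ^ (s + 1) := by
  have hvϖ : 0 < Valued.v ϖ := (Valuation.pos_iff _).2 hϖ0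
  obtain ⟨u, hu, hDu⟩ := h
  rw [mem_fixedUnitStabilizer_iff] at hu
  obtain ⟨hstab, hunit, -⟩ := hu
  obtain ⟨-, h20⟩ := (mem_latticeStabilizer_latt_rhoZero_iff hϖ0 (by omega : s ≤ 1 + s) hζ hy'' V hV u hunit).1 ((mem_latticeStabilizer_iff _ _).2 hstab)
  rw [Nat.add_sub_cancel, pow_one] at h20
  have hu2 : ((u 2 : Kˣ) : K) ≠ 0 := (u 2).ne_zero
  have e : (D 0 + σ y'' * D 2 * y'') / D 2 - (D' 0 + σ y'' * D' 2 * y'') / D' 2 = D 0 / D 2 * (((u 2 : Kˣ) : K) - u 0) / u 2 := by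
    rw [hDu 0, hDu 2]; field_simp; ring
  rw [e, map_div₀, map_mul, map_div₀, hvD0, hvD2, hunit 2, div_one, one_div, inv_inv, pow_succ]
  exact mul_le_mul' le_rfl h20

/-- **(P3₀) `|r(D) − r(D′)| ≤ |ϖ|^{s+1}` ⟹ `u := D′∕D ∈ S_F(latt V)`**: `u` is a fixed unit diagonal by (P1₀); `u₂ − u₀ = D′₂(r − r′)∕D₀` gives `|u₂ − u₀| ≤ |ϖ|`, and
`(u₂ − u₁)·D₂D₁·G₀₀G′₀₀ = G′₀₀D′₂κ − G₀₀D₂κ′ + N·D₂²D′₂²·(r′ − r)` (`κ = G₀₀G₁₁ − N·D₂²`, `N = Ny″Nζ`, the (P1₀) cofactor) gives `|u₂ − u₁| ≤ |ϖ|^{1+s}` — the two conditions of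
★ p856296 `mem_latticeStabilizer_latt_rhoZero_iff`. [cite: Kottwitz1986BaseChangeUnits, §1 pp. 240–241] [cite: Jacobowitz1962, §7] -/
theorem exists_stabiliser_of_v_ratio_sub_le_zero {σ : K →+* K} (hvσ : ∀ a, Valued.v (σ a) = Valued.v a)
    (hfix : ∀ x : K, σ x = x → x ≠ 0 → ∃ n : ℤ, Valued.v x = WithZero.exp (2 * n)) {ϖ : K} (hϖ : Valued.v ϖ = WithZero.exp (-1 : ℤ))
    (s : ℕ) (hs2 : 2 ∣ s) (hs : 1 ≤ s) {ζ y'' : K} (hζ : Valued.v ζ = 1) (hy'' : Valued.v y'' = Valued.v ϖ ^ s)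
    (V : GL (Fin 3) K) (hV : (V : Matrix (Fin 3) (Fin 3) K) = !![1, 0, 0; 0, 1, 0; y'', ζ, ϖ ^ (1 + s)])
    {D D' : Fin 3 → K} (hD : ∀ i, σ (D i) = D i ∧ D i ≠ 0) (hvert : IsVertexLattice σ ϖ (Matrix.diagonal D) 2 (latt (V : Matrix (Fin 3) (Fin 3) K)))
    (hD' : ∀ i, σ (D' i) = D' i ∧ D' i ≠ 0) (hvert' : IsVertexLattice σ ϖ (Matrix.diagonal D') 2 (latt (V : Matrix (Fin 3) (Fin 3) K)))
    (hle : Valued.v ((D 0 + σ y'' * D 2 * y'') / D 2 - (D' 0 + σ y'' * D' 2 * y'') / D' 2) ≤ Valued.v ϖ ^ (s + 1)) :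
    ∃ u ∈ fixedUnitStabilizer σ (latt (V : Matrix (Fin 3) (Fin 3) K)), ∀ i, D' i = D i * ((u i : Kˣ) : K) := by
  obtain ⟨hϖ0, hϖ1⟩ := ne_zero_and_v_lt_one_of_v_eq_exp hϖ
  have hvϖ : 0 < Valued.v ϖ := (Valuation.pos_iff _).2 hϖ0
  set Es : ℤᵐ⁰ := Valued.v ϖ ^ s with hEs
  have hEs0 : Es ≠ 0 := pow_ne_zero _ hvϖ.ne'
  obtain ⟨hvD2, ⟨ha, hE, hκ⟩, ⟨hvD0, hvD1⟩⟩ := structure_of_polarisation_zero hvσ hfix hϖ s hs2 hs hζ hy'' V hV hD hvert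
  obtain ⟨hvD2', ⟨ha', hE', hκ'⟩, ⟨hvD0', hvD1'⟩⟩ := structure_of_polarisation_zero hvσ hfix hϖ s hs2 hs hζ hy'' V hV hD' hvert'
  -- letters
  set a : K := D 0 + σ y'' * D 2 * y'' with hadef
  set a' : K := D' 0 + σ y'' * D' 2 * y'' with ha'def
  set E : K := D 1 + σ ζ * D 2 * ζ with hEdef
  set E' : K := D' 1 + σ ζ * D' 2 * ζ with hE'def
  set κ : K := a * E - σ y'' * y'' * (σ ζ * ζ) * D 2 ^ 2 with hκdef
  set κ' : K := a' * E' - σ y'' * y'' * (σ ζ * ζ) * D' 2 ^ 2 with hκ'def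
  have hD2 : D 2 ≠ 0 := (hD 2).2
  have hD2' : D' 2 ≠ 0 := (hD' 2).2
  have hD0 : D 0 ≠ 0 := (hD 0).2
  have hD1 : D 1 ≠ 0 := (hD 1).2
  have ha0 : a ≠ 0 := fun h => by rw [h, map_zero] at ha; exact zero_ne_one ha
  have ha0' : a' ≠ 0 := fun h => by rw [h, map_zero] at ha'; exact zero_ne_one ha'
  -- the quotient `u = D'∕D`: fixed units
  have hvq : ∀ i, Valued.v (D' i / D i) = 1 := by
    intro i
    rw [map_div₀, div_eq_one_iff_eq ((Valuation.ne_zero_iff _).2 (hD i).2)]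
    fin_cases i
    · exact hvD0'.trans hvD0.symm
    · exact hvD1'.trans hvD1.symm
    · exact hvD2'.trans hvD2.symm
  set u : Fin 3 → Kˣ := fun i => Units.mk0 (D' i / D i) (div_ne_zero (hD' i).2 (hD i).2) with hudef
  have hu : ∀ i, ((u i : Kˣ) : K) = D' i / D i := fun i => rfl
  have hDu : ∀ i, D' i = D i * ((u i : Kˣ) : K) := fun i => by rw [hu]; field_simp [(hD i).2]
  have hunit : ∀ i, Valued.v ((u i : Kˣ) : K) = 1 := fun i => by rw [hu]; exact hvq i
  have hfixu : ∀ i, σ ((u i : Kˣ) : K) = u i := fun i => by rw [hu, map_div₀, (hD i).1, (hD' i).1]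
  refine ⟨u, ?_, hDu⟩
  -- `|u₂ − u₀| ≤ |ϖ|`
  have h20 : Valued.v (((u 2 : Kˣ) : K) - u 0) ≤ Valued.v ϖ ^ (1 + s - s) := by
    rw [Nat.add_sub_cancel, pow_one]
    have e : ((u 2 : Kˣ) : K) - u 0 = D' 2 * ((D 0 + σ y'' * D 2 * y'') / D 2 - (D' 0 + σ y'' * D' 2 * y'') / D' 2) / D 0 := by
      rw [hu, hu]; field_simp; ring
    rw [e, map_div₀, map_mul, hvD0, div_one, hvD2']
    calc Es⁻¹ * Valued.v ((D 0 + σ y'' * D 2 * y'') / D 2 - (D' 0 + σ y'' * D' 2 * y'') / D' 2) ≤ Es⁻¹ * Valued.v ϖ ^ (s + 1) := mul_le_mul_right hle _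
      _ = Valued.v ϖ := by rw [pow_succ, ← hEs, ← mul_assoc, inv_mul_cancel₀ hEs0, one_mul]
  -- `|u₂ − u₁| ≤ |ϖ|^{1+s}`
  have h21 : Valued.v (((u 2 : Kˣ) : K) - u 1) ≤ Valued.v ϖ ^ (1 + s) := by
    have e : (((u 2 : Kˣ) : K) - u 1) * (D 2 * D 1 * (a * a')) =
        a' * D' 2 * κ - a * D 2 * κ' + σ y'' * y'' * (σ ζ * ζ) * (D 2 ^ 2 * D' 2 ^ 2) *
          ((D' 0 + σ y'' * D' 2 * y'') / D' 2 - (D 0 + σ y'' * D 2 * y'') / D 2) := by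
      rw [hu, hu, hκdef, hκ'def, hEdef, hE'def, hadef, ha'def]; field_simp; ring
    have hvN : Valued.v (σ y'' * y'' * (σ ζ * ζ) * (D 2 ^ 2 * D' 2 ^ 2)) = Es⁻¹ * Es⁻¹ := by
      rw [map_mul, map_mul, map_mul, map_mul, map_mul, map_pow, map_pow, hvσ, hvσ, hy'', hζ, hvD2, hvD2', ← hEs, mul_one, mul_one, sq,
        show Es * Es * (Es⁻¹ * Es⁻¹ * (Es⁻¹ * Es⁻¹)) = (Es * Es⁻¹) * (Es * Es⁻¹) * (Es⁻¹ * Es⁻¹) by ac_rfl, mul_inv_cancel₀ hEs0, one_mul, one_mul]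
    have hle' : Valued.v ((D' 0 + σ y'' * D' 2 * y'') / D' 2 - (D 0 + σ y'' * D 2 * y'') / D 2) ≤ Valued.v ϖ ^ (s + 1) := by rwa [Valuation.map_sub_swap]
    have hR : Valued.v (a' * D' 2 * κ - a * D 2 * κ' + σ y'' * y'' * (σ ζ * ζ) * (D 2 ^ 2 * D' 2 ^ 2) *
        ((D' 0 + σ y'' * D' 2 * y'') / D' 2 - (D 0 + σ y'' * D 2 * y'') / D 2)) ≤ Valued.v ϖ * Es⁻¹ := by
      refine (Valuation.map_add _ _ _).trans (max_le ((Valuation.map_sub _ _ _).trans (max_le ?_ ?_)) ?_)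
      · rw [map_mul, map_mul, ha', hvD2', one_mul, mul_comm]; exact mul_le_mul' hκ le_rfl
      · rw [map_mul, map_mul, ha, hvD2, one_mul, mul_comm]; exact mul_le_mul' hκ' le_rfl
      · rw [map_mul, hvN]
        calc Es⁻¹ * Es⁻¹ * Valued.v ((D' 0 + σ y'' * D' 2 * y'') / D' 2 - (D 0 + σ y'' * D 2 * y'') / D 2)
            ≤ Es⁻¹ * Es⁻¹ * Valued.v ϖ ^ (s + 1) := mul_le_mul_right hle' _
          _ = Valued.v ϖ * Es⁻¹ := by
              rw [pow_succ, ← hEs, show Es⁻¹ * Es⁻¹ * (Es * Valued.v ϖ) = (Es⁻¹ * Es) * (Valued.v ϖ * Es⁻¹) by ac_rfl, inv_mul_cancel₀ hEs0, one_mul]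
    have hden : Valued.v (D 2 * D 1 * (a * a')) = Es⁻¹ * Es⁻¹ := by rw [map_mul, map_mul, map_mul, hvD2, hvD1, ha, ha', mul_one, mul_one]
    have hfin : Valued.v (((u 2 : Kˣ) : K) - u 1) * (Es⁻¹ * Es⁻¹) ≤ (Valued.v ϖ ^ (1 + s)) * (Es⁻¹ * Es⁻¹) := by
      have h1 : Valued.v (((u 2 : Kˣ) : K) - u 1) * (Es⁻¹ * Es⁻¹) = Valued.v (a' * D' 2 * κ - a * D 2 * κ' + σ y'' * y'' * (σ ζ * ζ) * (D 2 ^ 2 * D' 2 ^ 2) *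
          ((D' 0 + σ y'' * D' 2 * y'') / D' 2 - (D 0 + σ y'' * D 2 * y'') / D 2)) := by rw [← hden, ← map_mul, e]
      rw [h1]
      refine hR.trans (le_of_eq ?_)
      rw [pow_add, pow_one, ← hEs, show Valued.v ϖ * Es * (Es⁻¹ * Es⁻¹) = Valued.v ϖ * Es⁻¹ * (Es * Es⁻¹) by ac_rfl, mul_inv_cancel₀ hEs0, mul_one]
    exact le_of_mul_le_mul_right hfin (mul_pos (inv_pos.2 (zero_lt_iff.2 hEs0)) (inv_pos.2 (zero_lt_iff.2 hEs0)))
  rw [mem_fixedUnitStabilizer_iff]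
  exact ⟨(mem_latticeStabilizer_iff _ _).1 ((mem_latticeStabilizer_latt_rhoZero_iff hϖ0 (by omega : s ≤ 1 + s) hζ hy'' V hV u hunit).2 ⟨h21, h20⟩), hunit, hfixu⟩

/-! ## §4  The relatedness criterion on the root-glued frame -/

/-- **THE STABILISER-RELATEDNESS CRITERION, `ρ = 0`**: on `V = (1 0 0; 0 1 0; y″ ζ ϖ^{1+s})` (`|ζ| = 1`, `|y″| = |ϖ|^s`, `s` even `≥ 2`) two fixed non-degenerate type-2 polarisations
`D, D′` of `latt V` lie in the same `S_F`-class iff `|(D₀ + Ny″D₂)∕D₂ − (D′₀ + Ny″D′₂)∕D′₂| ≤ |ϖ|^{s+1}`: the classes are `r(D) mod U_F(1)` on the fixed sphere `|r| = |ϖ|^s`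
— `q − 1` of them (FILE G2-C2). [cite: Kottwitz1986BaseChangeUnits, §1 pp. 240–241] [cite: Jacobowitz1962, §7] -/
theorem exists_stabiliser_iff_v_ratio_sub_le_zero {σ : K →+* K} (hvσ : ∀ a, Valued.v (σ a) = Valued.v a)
    (hfix : ∀ x : K, σ x = x → x ≠ 0 → ∃ n : ℤ, Valued.v x = WithZero.exp (2 * n)) {ϖ : K} (hϖ : Valued.v ϖ = WithZero.exp (-1 : ℤ))
    (s : ℕ) (hs2 : 2 ∣ s) (hs : 1 ≤ s) {ζ y'' : K} (hζ : Valued.v ζ = 1) (hy'' : Valued.v y'' = Valued.v ϖ ^ s)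
    (V : GL (Fin 3) K) (hV : (V : Matrix (Fin 3) (Fin 3) K) = !![1, 0, 0; 0, 1, 0; y'', ζ, ϖ ^ (1 + s)])
    {D D' : Fin 3 → K} (hD : ∀ i, σ (D i) = D i ∧ D i ≠ 0) (hvert : IsVertexLattice σ ϖ (Matrix.diagonal D) 2 (latt (V : Matrix (Fin 3) (Fin 3) K)))
    (hD' : ∀ i, σ (D' i) = D' i ∧ D' i ≠ 0) (hvert' : IsVertexLattice σ ϖ (Matrix.diagonal D') 2 (latt (V : Matrix (Fin 3) (Fin 3) K))) :
    (∃ u ∈ fixedUnitStabilizer σ (latt (V : Matrix (Fin 3) (Fin 3) K)), ∀ i, D' i = D i * ((u i : Kˣ) : K)) ↔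
      Valued.v ((D 0 + σ y'' * D 2 * y'') / D 2 - (D' 0 + σ y'' * D' 2 * y'') / D' 2) ≤ Valued.v ϖ ^ (s + 1) := by
  obtain ⟨hϖ0, -⟩ := ne_zero_and_v_lt_one_of_v_eq_exp hϖ
  obtain ⟨hvD2, -, ⟨hvD0, -⟩⟩ := structure_of_polarisation_zero hvσ hfix hϖ s hs2 hs hζ hy'' V hV hD hvert
  exact ⟨v_ratio_sub_le_of_exists_stabiliser_zero hϖ0 s hζ hy'' V hV (hD 2).2 hvD2 hvD0,
    exists_stabiliser_of_v_ratio_sub_le_zero hvσ hfix hϖ s hs2 hs hζ hy'' V hV hD hvert hD' hvert'⟩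

end Summit.HodgeConjecture.HodgeConjecture.Cruxes.H413.F0P3cDyRamDiagonalGluedZeroPolarisationClassesTypeTwo

end
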